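import Mathlib
import HarnessLib
import Summits.HubbardSuperconductivity.HubbardSuperconductivity.Theorems.KLProgrammeH10TwoPointLimitFrameBGM2003SectorCountingUniform
import Summits.HubbardSuperconductivity.HubbardSuperconductivity.Theorems.KLProgrammeKLRegimeSplitOnWindow
import Summits.HubbardSuperconductivity.HubbardSuperconductivity.Theorems.KLProgrammeKLRegimeSplitConsts

/-!
# Route `KLProgramme` — K3 engine child `KLRegimeEngineV17F2` (stmt-HubbardSuperconductivity-20437), stub (b) `(Hμ)`:
# BGM 2003's sector counting Lemma 3.1 (4.3) in `ℝ²` ON THE COVARIANCE WINDOW `klWindowC` WITH THE KL SHELL `klE0`, one constant for all admissible frames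

Cell gate-hubbard-kl, seat p4 (C5a), g12.  `frameOK_bgm2003_sectorCounting_uniform_shell` (`…FrameBGM2003SectorCountingUniform` §4) read at the
engine's level window `klWindowC = [-1.05, -0.15]` and the KL family's shell constant `klE0 = 1/32` (`-4 < -1.05 − 1/8`, `-0.15 + 1/8 < 0`): the
supports of `klAnisoFamily … klE0 n` lie in the shell `|ε₀ + δ_K − μ| < klE0·4^{−n}` (`support_klAnisoFamily`), i.e. inside the s-sectors of the
frame's chart with shell `klE0` — the form the stub-(b) binders consume (`μ ∈ klWindowC`, `FrameOK R U (nScales β) ν K`, `0 < c ≤ c₃`, `0 < U ≤ U₀`,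
`klBetaMin ≤ β ≤ e^{c/U²}`), with ONE constant `c′` chosen before `R`.  Proved by instantiation; no definitions, no named facts.
References: BGM 2003 §3.1 Lemma 3.1 (4.3), §7.4 [cite: BenfattoGiulianiMastropietro2003]; BGM 2006 §2.7–2.8, App. A3 [cite: BenfattoGiulianiMastropietro2006].
-/

noncomputable section

namespace Summit.HubbardSuperconductivity.HubbardSuperconductivity.Theorems.PerturbedFermiCurve

set_option linter.dupNamespace false -- summit = problem name (single-conjunct summit), D-0017

open Real Set
open Literature.MathematicalPhysics.QuantumLattice Literature.MathematicalPhysics.QuantumLattice.BandSectorCounting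
open Literature.MathematicalPhysics.QuantumLattice.FermiRG Literature.MathematicalPhysics.QuantumLattice.FermiRG.BGM2003
open Summit.HubbardSuperconductivity.HubbardSuperconductivity.Theorems.DispersionFlow
open Summit.HubbardSuperconductivity.HubbardSuperconductivity.Theorems.KLRegimeSplit

/-- **BGM 2003 Lemma 3.1 (4.3) on `klWindowC` with shell `klE0`, one constant for every admissible frame**: there is `c′ > 0` and, for every `R`
with `0 ≤ R.Gfr j`, thresholds `c₃, U₀ > 0` such that for all `0 < c ≤ c₃`, `0 < U ≤ U₀`, `klBetaMin ≤ β ≤ e^{c/U²}`, `μ ∈ klWindowC`, every frame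
with `FrameOK R U (nScales β) ν K` and all `n ≤ n′`: the number of scale-`n′` s-sector strings (shell `klE0`) of the curve `{ε₀ + δ_K = μ + e}`
refining given scale-`n` sectors (first entry fixed) and compatible with `Σ k⃗ᵢ = 0` in `ℝ²` is `≤ c′^L 2^{(n′−n)(L−3)}` (`L ≥ 4`), `≤ c′` (`L = 2`).
[cite: BenfattoGiulianiMastropietro2003, §3.1 Lemma 3.1 (4.3) and §7.4] -/
theorem frameOK_bgm2003_sectorCounting_klE0_window :
    ∃ c' : ℝ, 0 < c' ∧ ∀ R : RenConsts, (∀ j, 0 ≤ R.Gfr j) →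
      ∃ c₃ : ℝ, 0 < c₃ ∧ ∃ U₀ : ℝ, 0 < U₀ ∧
      ∀ c : ℝ, 0 < c → c ≤ c₃ → ∀ U : ℝ, 0 < U → U ≤ U₀ → ∀ β : ℝ, klBetaMin ≤ β → β ≤ Real.exp (c / U ^ 2) →
      ∀ μ ∈ klWindowC, ∀ (ν : ℝ) (K : TrigPolyC4v), FrameOK R U (nScales β) ν K →
      ∀ (n n' : ℕ), n ≤ n' →
        (∀ (L : ℕ) (i₁ : Fin L) (ω₁ : ℕ) (ωt : Fin L → ℕ), 4 ≤ L → ω₁ < sectorCount n' → (∀ i, ωt i < sectorCount n) →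
          (Nat.card (sectorStrings (fun ϑ e => perturbedFermiRadius (fun k : Fin 2 → ℝ => frameShift K (WithLp.toLp 2 k)) (μ + e) ϑ)
            klE0 n n' L i₁ ω₁ ωt) : ℝ) ≤ c' ^ L * (2 : ℝ) ^ ((n' - n) * (L - 3))) ∧
        (∀ (i₁ : Fin 2) (ω₁ : ℕ) (ωt : Fin 2 → ℕ), ω₁ < sectorCount n' → (∀ i, ωt i < sectorCount n) →
          (Nat.card (sectorStrings (fun ϑ e => perturbedFermiRadius (fun k : Fin 2 → ℝ => frameShift K (WithLp.toLp 2 k)) (μ + e) ϑ)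
            klE0 n n' 2 i₁ ω₁ ωt) : ℝ) ≤ c') :=
  frameOK_bgm2003_sectorCounting_uniform_shell (-1.05) (-0.15) klE0 (by norm_num [klE0]) (by norm_num [klE0]) (by norm_num)
    (by norm_num [klE0])

/-- The four-leg case on `klWindowC` with shell `klE0`: `≤ c′⁴·2^{n′−n}`. [cite: BenfattoGiulianiMastropietro2003, §3.1 Lemma 3.1 (4.3)] -/
theorem frameOK_bgm2003_sectorCounting_klE0_window_four :
    ∃ c' : ℝ, 0 < c' ∧ ∀ R : RenConsts, (∀ j, 0 ≤ R.Gfr j) →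
      ∃ c₃ : ℝ, 0 < c₃ ∧ ∃ U₀ : ℝ, 0 < U₀ ∧
      ∀ c : ℝ, 0 < c → c ≤ c₃ → ∀ U : ℝ, 0 < U → U ≤ U₀ → ∀ β : ℝ, klBetaMin ≤ β → β ≤ Real.exp (c / U ^ 2) →
      ∀ μ ∈ klWindowC, ∀ (ν : ℝ) (K : TrigPolyC4v), FrameOK R U (nScales β) ν K →
      ∀ (n n' : ℕ), n ≤ n' → ∀ (i₁ : Fin 4) (ω₁ : ℕ) (ωt : Fin 4 → ℕ), ω₁ < sectorCount n' → (∀ i, ωt i < sectorCount n) →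
          (Nat.card (sectorStrings (fun ϑ e => perturbedFermiRadius (fun k : Fin 2 → ℝ => frameShift K (WithLp.toLp 2 k)) (μ + e) ϑ)
            klE0 n n' 4 i₁ ω₁ ωt) : ℝ) ≤ c' ^ 4 * (2 : ℝ) ^ (n' - n) := by
  obtain ⟨c', hc', h⟩ := frameOK_bgm2003_sectorCounting_klE0_window
  refine ⟨c', hc', fun R hR => ?_⟩
  obtain ⟨c₃, hc₃, U₀, hU₀, hreg⟩ := h R hR
  refine ⟨c₃, hc₃, U₀, hU₀, ?_⟩
  intro c hc hcle U hU hUle β hβmin hβc μ hμ ν K hK n n' hn i₁ ω₁ ωt hω₁ hωt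
  have h4 := (hreg c hc hcle U hU hUle β hβmin hβc μ hμ ν K hK n n' hn).1 4 i₁ ω₁ ωt le_rfl hω₁ hωt
  simpa using h4

end Summit.HubbardSuperconductivity.HubbardSuperconductivity.Theorems.PerturbedFermiCurve

end
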